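import Literature.Barriers.SmoothPoincare4.OneStabilisationContractibleProofs
import HarnessLib

/-!
# `kang2022_oneStabilisationExoticPair` one level down: Kang's Thm. 1.1 and the stabilised Akbulut–Ruberman construction

Second sibling proof file of `Literature/Barriers/SmoothPoincare4/OneStabilisationContractible.lean`
(barrier `Literature.Barriers.SmoothPoincare4.OneStabilisationBarrier`, proved there from Kang's
Cor. 1.2; `OneStabilisationContractibleProofs.lean` reduces Cor. 1.2 to the named fact
`kang2022_oneStabilisationExoticPair` — the pair `(V, V′)` of Kang's proof — plus Freedman–Quinn).
This file splits `kang2022_oneStabilisationExoticPair` along the two sentences of its printed proof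
(Kang, arXiv:2210.07510v3, §5, proof of Cor. 1.2, pp. 20–21):

> "By Theorem 1.1, we know that there exists a cork `(W, Y, f)` such that `f` does not extend
> smoothly to `W ♯ (S² × S²)`." — the Floer-theoretic input, vendored as the named fact
> `kang2022_theorem11`;
>
> "By following the arguments used in the proof of [AR16, Theorem A], one can construct a homology
> cobordism `X` from `Y` to another homology sphere `N`, admitting a left inverse `X̄` ... such that
> any self-diffeomorphism of `N` extends to a self-diffeomorphism of `X` which acts by identity on
> `Y`. Then we consider the 4-manifolds `V = W ∪ X`, `V′ = W ∪_f X`, which are simply-connected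
> homology balls ... so that they are contractible ... Then one can simply follow the remaining
> part of the proof of [AR16, Theorem A] to conclude that there exists no diffeomorphism between
> `V ♯ (S² × S²)` and `V′ ♯ (S² × S²)`." — the differential-topological mechanism (Akbulut–Ruberman
> 2016, §§2–3, run with `W ♯ (S² × S²)` in place of `W`), vendored as the named fact
> `kang2022_akbulutRubermanStabilised`,

and PROVES the fact from the two (`kang2022_oneStabilisationExoticPair_of_theorem11`), hence
Cor. 1.2 and the barrier from the two plus Freedman–Quinn
(`kang2022_corollary12_of_theorem11`, `oneStabilisationBarrier_of_theorem11`).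

To state Thm. 1.1 one needs the phrase "`f : ∂W ≃ ∂W` extends to a self-diffeomorphism of
`W ♯ (S² × S²)`", which the relational `Literature.Topology.FourManifolds.IsConnectedSum` (gluing
embeddings hidden in an `∃`) cannot express — scope caveat (c) of the barrier docstring. The new
notion `ExtendsOverStabilisation b f` makes the gluing data explicit: SOME smooth 4-manifold with
boundary `P`, presented as `W ♯ (S² × S²)` by disc embeddings `i₁ : ℝ⁴ → W`,
`i₂ : ℝ⁴ → S² × S²` and open smooth embeddings `jA : W ∖ {i₁ 0} → P`,
`jB : (S² × S²) ∖ {i₂ 0} → P` exactly as inside `IsConnectedSum` (Kervaire–Milnor relation), with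
the disc centre `i₁ 0` off `∂W`, carries a self-diffeomorphism `Φ` with
`Φ ∘ jA ∘ incl = jA ∘ incl ∘ f` on `∂W`. Thm. 1.1 is then `∃` a cork `(W, ∂W, f)` with
`¬ ExtendsOverStabilisation b f` (no presentation at all carries an extension — the reading of
"does not extend to `W ♯ (S² × S²)`" forced by the absence of a preferred representative of the
relational sum; for connected `W` all presentations are diffeomorphic relative to `jA ∘ incl` by the
disc theorem (Palais 1960, Kosinski VI.1) and the orientation-reversing symmetry of `S² × S²`, so in
truth the `∀`- and `∃`-readings agree; Kang's proof, via the involutive cobordism maps of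
`W ♯ (S² × S²)`, is insensitive to the presentation).

Resulting dependency graph (all arrows proved in the tree):
`OneStabilisationBarrier ⇔ kang2022_corollary12 ⇐ kang2022_oneStabilisationExoticPair ∧ FQ`,
`kang2022_oneStabilisationExoticPair ⇐ kang2022_theorem11 ∧ kang2022_akbulutRubermanStabilised`.
The leaf `kang2022_theorem11` is involutive bordered Heegaard Floer homology (Kang §§2–5) and is
not attempted. The leaf `kang2022_akbulutRubermanStabilised` is classical differential topology
(Akbulut–Ruberman's invertible homology cobordism with tame boundary symmetries — hyperbolic
link complements with trivial symmetry group, the doubly slice knot `11n42`, JSJ and Waldhausen —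
plus gluing of diffeomorphisms along collars, the disc theorem, van Kampen, Mayer–Vietoris and
Whitehead's theorem); its further decomposition is recorded in the unit's notes, not here.

## What is printed

* Kang (arXiv:2210.07510v3), Thm. 1.1 (p. 1): "There exists a cork `(Y, W, f)` such that `f` does
  not extend to a self-diffeomorphism of `W ♯ (S² × S²)`."; the definition used (§1 p. 1 and §3
  p. 11): "A triple `(Y, W, f)` is said to be a cork if • `Y` is a homology 3-sphere, • `W` is a
  contractible 4-manifold with an identification `∂W = Y`, • `f : Y → Y` is a self-diffeomorphism
  of `Y` which does not extend smoothly to `W`; note that `f` always extends to a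
  self-homeomorphism `W` by Freedman's theorem" — NO involutivity is required (the cork of the
  proof, §3 p. 12, is `(S³₊₁(K ♯ −K), B⁴₊₁(D_{K,id}), F)` with `F` induced by a swap composed with
  a half Dehn twist); §3 p. 12: "Proving that this cork survives a stabilization ... is equivalent
  to showing that `B⁴₊₁(D_{K,id}) ♯ (S² × S²)` and `B⁴₊₁(D_{K,f}) ♯ (S² × S²)` are not diffeomorphic
  rel boundary."; proof of Cor. 1.2 (§5, pp. 20–21) as quoted above.
* Akbulut–Ruberman 2016 (arXiv:1410.1461 = Comment. Math. Helv. 91), Def. 2.1 (invertible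
  cobordism), Lemma 2.3 (the invertible homology cobordism `X` from a framed link and invertible
  concordances; `π₁`-isomorphism), Cor. 2.5 (links with hyperbolic, asymmetric complement),
  Prop. 2.6 (`11n42`), and the proof of Thm. A (§3): "Claim: The group of diffeomorphisms of `N`
  mod isotopy is isomorphic to `⊕ (ℤ ⊕ ℤ)`, and every element extends over the cobordism `X` in
  such a way that it is isotopic to the identity on `M`." ... "Write `V′` for `X ∪_f W` ... If `V′`
  were diffeomorphic to `V`, preserving this marking, then we could glue this diffeomorphism to the
  identity of `X̄` to get a diffeomorphism `X̄ ∪_N X ∪_f W ≅ W`. But `X̄ ∪_N X ≅ N × I` ... It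
  follows that (this) would result in a diffeomorphism of `(W, f)` with `(W, id)`" ... "Since `V`
  and `V′` are simply connected homology balls, they are contractible".

## Rendering choices (wording risks for the reviewer)

* Kang's corks versus the tree's `Literature.Topology.FourManifolds.IsCork`: the latter (Akbulut
  2016, Def. 10.1) asks for an INVOLUTION extending to a self-homeomorphism; Kang's definition asks
  neither. `kang2022_theorem11` therefore renders the cork as in the sibling files
  (`akbulut1991_mazurCork`, `akbulutRuberman2016_theoremA_contractible`): a compact (Hausdorff,
  second countable) contractible smooth `W`, a boundary datum `b`, a self-diffeomorphism `f` of
  `∂W` with `¬ ExtendsToDiffeomorph b f`. "`Y` is a homology 3-sphere" is omitted (it holds for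
  the boundary of every compact contractible 4-manifold, Poincaré–Lefschetz; omitting a true
  conjunct weakens the `∃`); the homeomorphic extension is the tree's Freedman–Quinn fact
  (`akbulut1991_mazurCork_of_theorem11`). Compactness of `W` is implicit in print (a handlebody).
* `ExtendsOverStabilisation` carries `T2Space`, `SecondCountableTopology`, `IsManifold` for the
  sum `P`, as all statements of this catalogue entry do; the hypothesis `hb : ∀ x, incl x ∈ W ∖ {i₁ 0}`
  (the disc centre is not a boundary point — automatic for a smooth embedding of `ℝ⁴`, kept as an
  explicit datum so that `jA (incl x)` typechecks) is part of the `∃`.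
* `kang2022_akbulutRubermanStabilised` is the implication Kang prints as the proof of Cor. 1.2
  minus Thm. 1.1 and minus "hence homeomorphic": for EVERY compact contractible `W` and boundary
  diffeomorphism `f` extending over no `W ♯ (S² × S²)`, the pair `(V, V′)` exists, with the
  conclusion in the shape of `kang2022_oneStabilisationExoticPair` (boundary data with
  `∂V ≅ ∂V′` — in print both boundaries ARE `N` —, the sums in `∃`-form over the relational
  `IsConnectedSum`, non-diffeomorphic). Only contractibility of `W` and the non-extension are
  used by the printed argument (the cork clause `¬ ExtendsToDiffeomorph b f` is not), so only they
  are hypotheses. Universe `0` throughout, as in the barrier file.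

## References

[Kang2022OneStabilization] [AkbulutRuberman2016] [FreedmanQuinn1990] [KervaireMilnorAnnals1963]
-/

noncomputable section

open scoped Manifold ContDiff
open Set Function

namespace Literature.Barriers.SmoothPoincare4

universe u

/-- Local notation: `𝕊 n` is the unit sphere in `EuclideanSpace ℝ (Fin (n + 1))`, the standard
`n`-sphere with its Mathlib manifold structure. -/
local notation "𝕊 " n:arg => (Metric.sphere (0 : EuclideanSpace ℝ (Fin (n + 1))) 1)

/-- Local notation: `𝔼 n` is the model Euclidean space `EuclideanSpace ℝ (Fin n)`. -/
local notation "𝔼 " n:arg => EuclideanSpace ℝ (Fin n)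

/-! ### Extension of a boundary diffeomorphism over a one-fold stabilisation -/

section Notion

variable {W : Type u} [TopologicalSpace W] [T2Space W] [ChartedSpace (EuclideanHalfSpace 4) W]

/-- **`f : ∂W ≃ ∂W` extends to a self-diffeomorphism of `W ♯ (S² × S²)`** (for some presentation
of the connected sum). There are a smooth 4-manifold with boundary `P` (Hausdorff, second
countable, model `𝓡∂ 4`) and data presenting `P` as a connected sum of `W` and `S² × S²` exactly as
inside `Literature.Topology.FourManifolds.IsConnectedSum (𝓡∂ 4) (𝓡∂ 4) ((𝓡 2).prod (𝓡 2)) W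
(S² × S²) P` — smooth disc embeddings `i₁ : ℝ⁴ → W`, `i₂ : ℝ⁴ → S² × S²` and open smooth
embeddings `jA : W ∖ {i₁ 0} → P`, `jB : (S² × S²) ∖ {i₂ 0} → P` covering `P` and identifying
precisely the Kervaire–Milnor-related points `i₁ (t • u) ∼ i₂ ((1 - t) • u)` — with the disc
centre `i₁ 0` off the boundary (`hb : incl x ∈ W ∖ {i₁ 0}`, i.e. `incl x ≠ i₁ 0`, for all
`x : ∂W`, so that `jA ∘ incl : ∂W → P` makes sense — it parametrises `∂P`), together with a diffeomorphism `Φ : P ≃ₘ P` such that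
`Φ (jA (incl x)) = jA (incl (f x))` for all `x : ∂W`: "`f` extends smoothly to a
self-diffeomorphism of `W ♯ (S² × S²)`" (Kang, §1). The connected sum being relational in this
tree (no preferred representative), the presentation is part of the witness; its negation says
that `f` extends over NO presentation, cf. `kang2022_theorem11`.
[cite: Kang2022OneStabilization, §1 (statement of Thm. 1.1) and §3] -/
def ExtendsOverStabilisation (b : Literature.Topology.FourManifolds.BoundaryData (𝓡∂ 4) W (𝓡 3))
    (f : b.carrier ≃ₘ⟮𝓡 3, 𝓡 3⟯ b.carrier) : Prop :=
  ∃ (P : Type u) (_ : TopologicalSpace P) (_ : T2Space P) (_ : SecondCountableTopology P)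
    (_ : ChartedSpace (EuclideanHalfSpace 4) P) (_ : IsManifold (𝓡∂ 4) ∞ P)
    (i₁ : 𝔼 4 → W) (i₂ : 𝔼 4 → (𝕊 2) × (𝕊 2))
    (jA : Literature.Topology.FourManifolds.puncture i₁ → P)
    (jB : Literature.Topology.FourManifolds.puncture i₂ → P),
    Manifold.IsSmoothEmbedding 𝓘(ℝ, 𝔼 4) (𝓡∂ 4) ∞ i₁ ∧
    Manifold.IsSmoothEmbedding 𝓘(ℝ, 𝔼 4) ((𝓡 2).prod (𝓡 2)) ∞ i₂ ∧
    (Manifold.IsSmoothEmbedding (𝓡∂ 4) (𝓡∂ 4) ∞ jA ∧ IsOpen (range jA) ∧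
      Manifold.IsSmoothEmbedding ((𝓡 2).prod (𝓡 2)) (𝓡∂ 4) ∞ jB ∧ IsOpen (range jB) ∧
      range jA ∪ range jB = univ ∧
      ∀ a c, jA a = jB c ↔ Literature.Topology.FourManifolds.connectedSumRel i₁ i₂ a c) ∧
    ∃ (hb : ∀ x : b.carrier, b.incl x ∈ Literature.Topology.FourManifolds.puncture i₁)
      (Φ : P ≃ₘ⟮𝓡∂ 4, 𝓡∂ 4⟯ P),
      ∀ x : b.carrier, Φ (jA ⟨b.incl x, hb x⟩) = jA ⟨b.incl (f x), hb (f x)⟩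

variable {b : Literature.Topology.FourManifolds.BoundaryData (𝓡∂ 4) W (𝓡 3)}

/-- The sum `P` over which `f` extends is a connected sum `W ♯ (S² × S²)` in the tree's relational
sense (`Literature.Topology.FourManifolds.IsConnectedSum`): forget `Φ` and repackage the gluing
data. [cite: KervaireMilnorAnnals1963, §2] -/
theorem ExtendsOverStabilisation.exists_isConnectedSum {f : b.carrier ≃ₘ⟮𝓡 3, 𝓡 3⟯ b.carrier}
    (h : ExtendsOverStabilisation b f) :
    ∃ (P : Type u) (_ : TopologicalSpace P) (_ : T2Space P) (_ : SecondCountableTopology P)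
      (_ : ChartedSpace (EuclideanHalfSpace 4) P) (_ : IsManifold (𝓡∂ 4) ∞ P),
      Literature.Topology.FourManifolds.IsConnectedSum (𝓡∂ 4) (𝓡∂ 4) ((𝓡 2).prod (𝓡 2)) W
        ((𝕊 2) × (𝕊 2)) P := by
  obtain ⟨P, _, _, _, _, _, i₁, i₂, jA, jB, h₁, h₂, hG, -⟩ := h
  exact ⟨P, ‹_›, ‹_›, ‹_›, ‹_›, ‹_›, i₁, i₂, h₁, h₂, jA, jB, hG⟩

/-- If `f` extends over a presentation of `W ♯ (S² × S²)` (by `Φ`), then so does `f⁻¹` (by `Φ⁻¹`,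
over the same presentation). [folklore] -/
theorem ExtendsOverStabilisation.symm {f : b.carrier ≃ₘ⟮𝓡 3, 𝓡 3⟯ b.carrier}
    (h : ExtendsOverStabilisation b f) : ExtendsOverStabilisation b f.symm := by
  obtain ⟨P, _, _, _, _, _, i₁, i₂, jA, jB, h₁, h₂, hG, hb, Φ, hΦ⟩ := h
  refine ⟨P, ‹_›, ‹_›, ‹_›, ‹_›, ‹_›, i₁, i₂, jA, jB, h₁, h₂, hG, hb, Φ.symm, fun x => ?_⟩
  have key : Φ (jA ⟨b.incl (f.symm x), hb (f.symm x)⟩) = jA ⟨b.incl x, hb x⟩ := by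
    rw [hΦ (f.symm x)]
    congr 1
    exact Subtype.ext (congrArg b.incl (f.apply_symm_apply x))
  rw [← key, Diffeomorph.symm_apply_apply]

/-- Over any presentation of `W ♯ (S² × S²)` with the disc centre off `∂W`, the identity of `∂W`
extends (by the identity of the sum): `ExtendsOverStabilisation b id` holds as soon as a
presentation exists. [folklore] -/
theorem extendsOverStabilisation_refl_of_presentation {P : Type u} [TopologicalSpace P] [T2Space P]
    [SecondCountableTopology P] [ChartedSpace (EuclideanHalfSpace 4) P] [IsManifold (𝓡∂ 4) ∞ P]
    {i₁ : 𝔼 4 → W} {i₂ : 𝔼 4 → (𝕊 2) × (𝕊 2)}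
    {jA : Literature.Topology.FourManifolds.puncture i₁ → P}
    {jB : Literature.Topology.FourManifolds.puncture i₂ → P}
    (h₁ : Manifold.IsSmoothEmbedding 𝓘(ℝ, 𝔼 4) (𝓡∂ 4) ∞ i₁)
    (h₂ : Manifold.IsSmoothEmbedding 𝓘(ℝ, 𝔼 4) ((𝓡 2).prod (𝓡 2)) ∞ i₂)
    (hG : Manifold.IsSmoothEmbedding (𝓡∂ 4) (𝓡∂ 4) ∞ jA ∧ IsOpen (range jA) ∧
      Manifold.IsSmoothEmbedding ((𝓡 2).prod (𝓡 2)) (𝓡∂ 4) ∞ jB ∧ IsOpen (range jB) ∧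
      range jA ∪ range jB = univ ∧
      ∀ a c, jA a = jB c ↔ Literature.Topology.FourManifolds.connectedSumRel i₁ i₂ a c)
    (hb : ∀ x : b.carrier, b.incl x ∈ Literature.Topology.FourManifolds.puncture i₁) :
    ExtendsOverStabilisation b (Diffeomorph.refl (𝓡 3) b.carrier ∞) :=
  ⟨P, ‹_›, ‹_›, ‹_›, ‹_›, ‹_›, i₁, i₂, jA, jB, h₁, h₂, hG, hb, Diffeomorph.refl (𝓡∂ 4) P ∞,
    fun _ => rfl⟩

end Notion

/-! ### Named facts: Kang's Thm. 1.1 and the stabilised Akbulut–Ruberman construction -/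

/-- **Kang 2022, Thm. 1.1 (named fact): a cork that survives one stabilisation.** There are a
compact (Hausdorff, second countable) contractible smooth 4-manifold `W` with boundary datum `b`
and a self-diffeomorphism `f` of `∂W` which extends to no self-diffeomorphism of `W` (a cork in
Kang's sense: "`Y` is a homology 3-sphere, `W` is a contractible 4-manifold with an identification
`∂W = Y`, `f : Y → Y` is a self-diffeomorphism of `Y` which does not extend smoothly to `W`") and
which extends to no self-diffeomorphism of `W ♯ (S² × S²)` — over no presentation of the sum,
`¬ ExtendsOverStabilisation b f` ("Theorem 1.1. There exists a cork `(Y, W, f)` such that `f` does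
not extend to a self-diffeomorphism of `W ♯ (S² × S²)`."; the cork is
`(S³₊₁(K ♯ −K), B⁴₊₁(D_{K,id}), F)` for `K = K₀ ♯ K₀`, `K₀ = (2T₄,₅ ♯ −T₄,₉)₃,₋₁`, detected by
involutive bordered Heegaard Floer homology, Lemma 5.1 and Prop. 4.6). Not rendered: "`Y` is a
homology 3-sphere" (true for the boundary of any compact contractible 4-manifold; its omission
weakens the `∃`) and involutivity of `f` (not claimed in print); the homeomorphic extension of `f`
("`f` always extends to a self-homeomorphism of `W` by Freedman's theorem") is the tree's
Freedman–Quinn fact, see `akbulut1991_mazurCork_of_theorem11`. Users take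
`(h : kang2022_theorem11)`. [cite: Kang2022OneStabilization, Thm. 1.1 (with the definition of §1/§3 and the cork of §3)] -/
def kang2022_theorem11 : Prop :=
  ∃ (W : Type) (_ : TopologicalSpace W) (_ : T2Space W) (_ : SecondCountableTopology W)
    (_ : ChartedSpace (EuclideanHalfSpace 4) W) (_ : IsManifold (𝓡∂ 4) ∞ W) (_ : CompactSpace W)
    (_ : ContractibleSpace W) (b : Literature.Topology.FourManifolds.BoundaryData (𝓡∂ 4) W (𝓡 3))
    (f : b.carrier ≃ₘ⟮𝓡 3, 𝓡 3⟯ b.carrier),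
    ¬ Literature.Topology.FourManifolds.ExtendsToDiffeomorph b f ∧ ¬ ExtendsOverStabilisation b f

/-- **The stabilised Akbulut–Ruberman construction (named fact; Kang's proof of Cor. 1.2 from
Thm. 1.1, following Akbulut–Ruberman's proof of their Thm. A).** Let `W` be a compact (Hausdorff,
second countable) contractible smooth 4-manifold with boundary datum `b`, and `f` a
self-diffeomorphism of `∂W` that extends to no self-diffeomorphism of `W ♯ (S² × S²)`
(`¬ ExtendsOverStabilisation b f`). Then there are compact contractible smooth 4-manifolds `V`, `V′`
with diffeomorphic boundaries and connected sums `P` of `V` and `P′` of `V′` with `S² × S²` which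
are not diffeomorphic. In print: with `Y = ∂W`, "one can construct a homology cobordism `X` from
`Y` to another homology sphere `N`, admitting a left inverse `X̄`, i.e. `X̄ ∪_N X ≃ Y × I`, such
that any self-diffeomorphism of `N` extends to a self-diffeomorphism of `X` which acts by identity
on `Y`" (Akbulut–Ruberman's Lemma 2.3, Cor. 2.5, Prop. 2.6 and the Claim in the proof of Thm. A);
"`V = W ∪ X`, `V′ = W ∪_f X`, which are simply-connected homology balls ..., so that they are
contractible" (both with boundary `N`); "Then one can simply follow the remaining part of the proof
of [AR16, Theorem A] to conclude that there exists no diffeomorphism between `V ♯ (S² × S²)` and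
`V′ ♯ (S² × S²)`" (a diffeomorphism would restrict to `g` on `N`, `g⁻¹` extends over `X` as the
identity on `Y`, and gluing `X̄` would extend `f` over `W ♯ (S² × S²)`). Hypotheses are exactly
what this argument uses (contractible compact `W`; non-extension of `f` over the stabilisation);
conclusion in the shape of `kang2022_oneStabilisationExoticPair` (boundary data with `∂V ≅ ∂V′`,
the sums in `∃`-form over the relational `Literature.Topology.FourManifolds.IsConnectedSum`,
`IsEmpty (P ≃ₘ P′)`). The unstabilised statement is the tree's
`akbulutRuberman2016_theoremA_contractible`. Users take
`(h : kang2022_akbulutRubermanStabilised)`.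
[cite: Kang2022OneStabilization, proof of Cor. 1.2 (§5)] [cite: AkbulutRuberman2016, Lemma 2.3, Cor. 2.5, Prop. 2.6 and proof of Thm. A (§3)] -/
def kang2022_akbulutRubermanStabilised : Prop :=
  ∀ (W : Type) [TopologicalSpace W] [T2Space W] [SecondCountableTopology W]
    [ChartedSpace (EuclideanHalfSpace 4) W] [IsManifold (𝓡∂ 4) ∞ W] [CompactSpace W]
    [ContractibleSpace W] (b : Literature.Topology.FourManifolds.BoundaryData (𝓡∂ 4) W (𝓡 3))
    (f : b.carrier ≃ₘ⟮𝓡 3, 𝓡 3⟯ b.carrier), ¬ ExtendsOverStabilisation b f →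
    ∃ (V V' : Type) (_ : TopologicalSpace V) (_ : T2Space V) (_ : SecondCountableTopology V)
      (_ : ChartedSpace (EuclideanHalfSpace 4) V) (_ : IsManifold (𝓡∂ 4) ∞ V) (_ : CompactSpace V)
      (_ : ContractibleSpace V)
      (_ : TopologicalSpace V') (_ : T2Space V') (_ : SecondCountableTopology V')
      (_ : ChartedSpace (EuclideanHalfSpace 4) V') (_ : IsManifold (𝓡∂ 4) ∞ V')
      (_ : CompactSpace V') (_ : ContractibleSpace V')
      (bV : Literature.Topology.FourManifolds.BoundaryData (𝓡∂ 4) V (𝓡 3))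
      (bV' : Literature.Topology.FourManifolds.BoundaryData (𝓡∂ 4) V' (𝓡 3))
      (P P' : Type) (_ : TopologicalSpace P) (_ : T2Space P) (_ : SecondCountableTopology P)
      (_ : ChartedSpace (EuclideanHalfSpace 4) P) (_ : IsManifold (𝓡∂ 4) ∞ P)
      (_ : TopologicalSpace P') (_ : T2Space P') (_ : SecondCountableTopology P')
      (_ : ChartedSpace (EuclideanHalfSpace 4) P') (_ : IsManifold (𝓡∂ 4) ∞ P'),
      Nonempty (bV.carrier ≃ₘ⟮𝓡 3, 𝓡 3⟯ bV'.carrier) ∧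
        Literature.Topology.FourManifolds.IsConnectedSum (𝓡∂ 4) (𝓡∂ 4) ((𝓡 2).prod (𝓡 2)) V
          ((𝕊 2) × (𝕊 2)) P ∧
        Literature.Topology.FourManifolds.IsConnectedSum (𝓡∂ 4) (𝓡∂ 4) ((𝓡 2).prod (𝓡 2)) V'
          ((𝕊 2) × (𝕊 2)) P' ∧
        IsEmpty (P ≃ₘ⟮𝓡∂ 4, 𝓡∂ 4⟯ P')

/-! ### The exotic pair, Cor. 1.2 and the barrier from the two leaves -/

/-- **`kang2022_oneStabilisationExoticPair` from the two sentences of its printed proof**: the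
cork of Thm. 1.1 (`h11`) fed into the stabilised Akbulut–Ruberman construction (`hAR`).
[cite: Kang2022OneStabilization, proof of Cor. 1.2 (§5)] -/
theorem kang2022_oneStabilisationExoticPair_of_theorem11 (h11 : kang2022_theorem11)
    (hAR : kang2022_akbulutRubermanStabilised) : kang2022_oneStabilisationExoticPair := by
  obtain ⟨W, _, _, _, _, _, _, _, b, f, -, hS⟩ := h11
  obtain ⟨V, V', _, _, _, _, _, _, _, _, _, _, _, _, _, _, bV, bV', P, P', _, _, _, _, _, _, _, _,
    _, _, hB, hP, hP', hE⟩ := hAR W b f hS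
  exact ⟨V, V', ‹_›, ‹_›, ‹_›, ‹_›, ‹_›, ‹_›, ‹_›, ‹_›, ‹_›, ‹_›, ‹_›, ‹_›, ‹_›, ‹_›, bV, bV',
    P, P', ‹_›, ‹_›, ‹_›, ‹_›, ‹_›, ‹_›, ‹_›, ‹_›, ‹_›, ‹_›, hB, hP, hP', hE⟩

/-- **Kang's Cor. 1.2 (as rendered) from Thm. 1.1, the stabilised Akbulut–Ruberman construction
and Freedman–Quinn** (`kang2022_corollary12_of_exoticPair` after
`kang2022_oneStabilisationExoticPair_of_theorem11`).
[cite: Kang2022OneStabilization, Cor. 1.2 and its proof (§5)] -/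
theorem kang2022_corollary12_of_theorem11 (h11 : kang2022_theorem11)
    (hAR : kang2022_akbulutRubermanStabilised)
    (hF : freedmanQuinn1990_homeomorph_extends_contractible.{0}) : kang2022_corollary12 :=
  kang2022_corollary12_of_exoticPair (kang2022_oneStabilisationExoticPair_of_theorem11 h11 hAR) hF

/-- **`OneStabilisationBarrier` from the leaves**: Thm. 1.1 (`h11`), the stabilised
Akbulut–Ruberman construction (`hAR`) and Freedman–Quinn 11.1C (`hF`).
[cite: Kang2022OneStabilization, Thm. 1.1 and Cor. 1.2] -/
theorem oneStabilisationBarrier_of_theorem11 (h11 : kang2022_theorem11)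
    (hAR : kang2022_akbulutRubermanStabilised)
    (hF : freedmanQuinn1990_homeomorph_extends_contractible.{0}) : OneStabilisationBarrier :=
  oneStabilisationBarrier_of_exoticPair (kang2022_oneStabilisationExoticPair_of_theorem11 h11 hAR) hF

/-! ### Kang's cork is a cork in the sense of the sibling files -/

/-- The cork of Thm. 1.1 witnesses the cork fact `akbulut1991_mazurCork` of
`ExoticContractible.lean` (an existence statement: compact contractible `W`, a boundary
diffeomorphism extending to a self-homeomorphism but to no self-diffeomorphism), the homeomorphic
extension being supplied by Freedman–Quinn (`hF`, `extendsToHomeomorph_of_freedmanQuinn`) — "note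
that `f` always extends to a self-homeomorphism `W` by Freedman's theorem".
[cite: Kang2022OneStabilization, §1 (definition of a cork)] [cite: FreedmanQuinn1990, Prop. 11.1C (trivial group)] -/
theorem akbulut1991_mazurCork_of_theorem11 (h11 : kang2022_theorem11)
    (hF : freedmanQuinn1990_homeomorph_extends_contractible.{0}) : akbulut1991_mazurCork.{0} := by
  obtain ⟨W, _, _, _, _, _, _, _, b, f, hD, -⟩ := h11
  exact ⟨W, ‹_›, ‹_›, ‹_›, ‹_›, ‹_›, ‹_›, ‹_›, b, f, extendsToHomeomorph_of_freedmanQuinn hF b f, hD⟩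

/-- Under the master statement of the barrier file (one stabilisation suffices for compact
contractible 4-manifolds), together with Freedman–Quinn, the stabilised Akbulut–Ruberman
construction can produce no pair at all, so NO boundary diffeomorphism of a compact contractible
smooth 4-manifold fails to extend over every `W ♯ (S² × S²)`: the contrapositive reading of
`oneStabilisationBarrier_of_theorem11` at the level of Thm. 1.1.
[cite: Kang2022OneStabilization, Thm. 1.1 and Cor. 1.2] -/
theorem extendsOverStabilisation_of_oneStabilisationSuffices (h : OneStabilisationSufficesContractible)
    (hAR : kang2022_akbulutRubermanStabilised)
    (hF : freedmanQuinn1990_homeomorph_extends_contractible.{0})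
    {W : Type} [TopologicalSpace W] [T2Space W] [SecondCountableTopology W]
    [ChartedSpace (EuclideanHalfSpace 4) W] [IsManifold (𝓡∂ 4) ∞ W] [CompactSpace W]
    [ContractibleSpace W] (b : Literature.Topology.FourManifolds.BoundaryData (𝓡∂ 4) W (𝓡 3))
    (f : b.carrier ≃ₘ⟮𝓡 3, 𝓡 3⟯ b.carrier) : ExtendsOverStabilisation b f := by
  by_contra hS
  obtain ⟨V, V', _, _, _, _, _, _, _, _, _, _, _, _, _, _, bV, bV', P, P', _, _, _, _, _, _, _, _,
    _, _, ⟨ψ⟩, hP, hP', hE⟩ := hAR W b f hS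
  obtain ⟨e⟩ := h V V' bV bV' ⟨ψ⟩ (nonempty_homeomorph_of_freedmanQuinn hF bV bV' ⟨ψ.toHomeomorph⟩)
    P P' hP hP'
  exact hE.false e

end Literature.Barriers.SmoothPoincare4

end
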